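/-
Origin: expansion seat `planner-pub-hodgecm-pv07-0`, handover 2026-08-18T03:35:56Z (`HOME/pub-hodgecm-pv07/lean/Pv07/CompactFactor.lean`, md5 e172a274, 260 lines);
landed by the gen-5 packager in gate run 19 as `HodgeCM/PerL34/LocalFactors/CompactFactor.lean` (verbatim).
-/
/-
Copyright: pub-hodgecm formalisation cell (harness21, 2026). New file (not vendored).
Origin: pub-hodgecm-pv07 (DAG-NODE PROVER #07), node N31f = PerL v5 Lemma 4.2(b), proof step
"LOCAL FACTORS" (tex ll. 608–623).  This file: the COMPACT-PLACE PROJECTION FORMULA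
(tex ll. 612–617: archimedean and non-split finite places).
Intended final place: `HodgeCM/PerL34/LocalFactors/CompactFactor.lean` (packager's choice).
-/
import Mathlib

/-!
# N31f (ii) — the local factor at a compact place: `I_v(φ_v) = vol · ‖φ_v[χ̄'_v]‖²`

Verbatim (tex ll. 609, 612–617): "`I_v(φ_v) := ∫_{U(W_i)(L_{0,v})} ⟨ω_v(y)φ_v, φ_v⟩ χ'_v(y) dy`.
… and `I_v(φ_v) ≥ 0`, being the value at `χ̄'_v` of the Fourier transform of the positive-definite
function `m(y) := ⟨ω_v(y)φ_v, φ_v⟩` on the abelian group `U(W_i)(L_{0,v})`; it is `> 0` for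
suitable `φ_v`: at archimedean and at non-split finite `v` (compact group)
`I_v(φ_v) = vol · ‖φ_v[χ̄'_v]‖²` with `φ_v[χ̄'_v]` the `χ̄'_v`-isotypic component, which is non-zero
for suitable `φ_v`: at a real place `b` the `χ̄'_b`-isotypic part is the part singled out in
Lemma 4.1(a) (`U(W_{i,b})` acts there by `u^{-e_b(Ψ_i)} = χ̄'_b(u)`), and at a non-split finite `v`
every character occurs (local occurrence proved above)".

TYPING (pv07's; the carver's `LocalFactors.lean` stub was not yet published).  The compact abelian
group `U(W_i)(L_{0,v})` is ANY compact topological group `G` (commutativity is only used, through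
Mathlib, to know that its Haar measure is inversion invariant; the theorems below assume the
invariances directly), `ω_v|_{U(W_i)}` is ANY unitary representation `ρ : G →* (E →L[ℂ] E)` on a
complex Hilbert space `E` (`ρ g` preserves inner products; `g ↦ ρ g v` continuous), `χ'_v` is ANY
continuous unitary character `χ : G →* ℂ`, `‖χ g‖ = 1`, and `dy` is the Haar probability measure
(`vol = 1`; PerL's normalisation gives the maximal compact subgroup — here all of `G` — volume 1,
tex l. 627).  PerL's `⟨·,·⟩` is linear in the FIRST variable, Mathlib's `⟪·,·⟫_ℂ` in the second, so
PerL's `m(y) = ⟨ω(y)φ, φ⟩` is Mathlib's `⟪φ, ρ y φ⟫_ℂ`; with this reading the isotypic component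
that appears is the `χ̄`-isotypic one, `{v : ρ(g)v = χ̄(g)v}`, exactly as in the tex (l. 616).

PROVED here (kernel): with `P φ := ∫ χ(g) • ρ(g)φ dμ` (`isoProj`, PerL's `φ ↦ φ[χ̄']`):
* `P` maps into the `χ̄`-isotypic subspace and fixes it (`isoProj_mem_isotypic`,
  `isoProj_eq_self_of_mem`), hence `P ∘ P = P` (`isoProj_idem`); `P` is self-adjoint
  (`inner_isoProj_comm`);
* THE FORMULA `I(φ) := ∫ χ(g)·⟪φ, ρ(g)φ⟫ dμ = ‖P φ‖²` (`localFactor_eq_norm_sq`), so `I(φ) ≥ 0` is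
  real (`localFactor_re_nonneg`, `localFactor_im`) WITHOUT Bochner's theorem, and
  `I(φ) ≠ 0 ↔ P φ ≠ 0` (`localFactor_ne_zero_iff`);
* "non-zero for suitable `φ_v`": any nonzero `χ̄`-isotypic vector `v` has `I(v) = ‖v‖² > 0`
  (`localFactor_pos_of_isotypic`).  The EXISTENCE of such a vector is NOT this node: at real
  places it is Lemma 4.1(a) (node N27), at non-split finite places local occurrence (node N31a).
-/

set_option autoImplicit false

namespace HodgeCM
namespace PerL34
namespace LocalFactors

open MeasureTheory Complex
open scoped InnerProductSpace ComplexConjugate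

variable {G : Type*} [Group G] [TopologicalSpace G] [MeasurableSpace G]
variable {E : Type*} [NormedAddCommGroup E] [InnerProductSpace ℂ E] [CompleteSpace E]

/-- PerL's `φ ↦ φ[χ̄'_v]` (tex l. 614–615): the `χ̄`-isotypic projector
`P v = ∫_G χ(g) • ρ(g) v dμ(g)` for the Haar probability measure `μ`. -/
noncomputable def isoProj (μ : Measure G) (ρ : G →* (E →L[ℂ] E)) (χ : G →* ℂ) (v : E) : E :=
  ∫ g, χ g • ρ g v ∂μ

/-- PerL's local factor at a compact place (tex l. 609, 613), in Mathlib's inner-product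
convention: `I(φ) = ∫_G χ(g) · ⟪φ, ρ(g)φ⟫ dμ(g)` (`= ∫ ⟨ω(y)φ, φ⟩_{PerL} χ'(y) dy`). -/
noncomputable def localFactor (μ : Measure G) (ρ : G →* (E →L[ℂ] E)) (χ : G →* ℂ) (φ : E) : ℂ :=
  ∫ g, χ g * ⟪φ, ρ g φ⟫_ℂ ∂μ

/-- The `χ̄`-isotypic vectors: "`U(W_{i,b})` acts there by `u^{-e_b(Ψ_i)} = χ̄'_b(u)`" (l. 616). -/
def IsIsotypic (ρ : G →* (E →L[ℂ] E)) (χ : G →* ℂ) (v : E) : Prop :=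
  ∀ g : G, ρ g v = conj (χ g) • v

section algebra

variable {ρ : G →* (E →L[ℂ] E)} {χ : G →* ℂ}

omit [TopologicalSpace G] [MeasurableSpace G] in

/-- A unitary character has `χ(g)⁻¹ = χ̄(g)` and `χ(g⁻¹) = χ̄(g)`. -/
theorem char_inv_eq_conj (hχ1 : ∀ g, ‖χ g‖ = 1) (g : G) : χ g⁻¹ = conj (χ g) := by
  have hne : χ g ≠ 0 := by
    intro h
    have := hχ1 g
    rw [h, norm_zero] at this
    exact zero_ne_one this
  have hmul : χ g⁻¹ * χ g = 1 := by rw [← map_mul, inv_mul_cancel, map_one]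
  have : χ g⁻¹ = (χ g)⁻¹ := eq_inv_of_mul_eq_one_left hmul
  rw [this, inv_eq_conj (hχ1 g)]

omit [TopologicalSpace G] [MeasurableSpace G] in
/-- (Ported verbatim from the HodgeCMPerL package; no docstring in the source.) -/
theorem char_mul_conj (hχ1 : ∀ g, ‖χ g‖ = 1) (g : G) : χ g * conj (χ g) = 1 := by
  rw [mul_conj, normSq_eq_norm_sq, hχ1 g]
  norm_num

omit [TopologicalSpace G] [MeasurableSpace G] in
/-- (Ported verbatim from the HodgeCMPerL package; no docstring in the source.) -/
theorem conj_char_mul (hχ1 : ∀ g, ‖χ g‖ = 1) (g : G) : conj (χ g) * χ g = 1 := by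
  rw [mul_comm, char_mul_conj hχ1 g]

omit [TopologicalSpace G] [MeasurableSpace G] [CompleteSpace E] in
/-- Unitarity in adjoint form: `⟪ρ(g)v, w⟫ = ⟪v, ρ(g⁻¹)w⟫`. -/
theorem inner_rep_left (hρu : ∀ g (v w : E), ⟪ρ g v, ρ g w⟫_ℂ = ⟪v, w⟫_ℂ) (g : G) (v w : E) :
    ⟪ρ g v, w⟫_ℂ = ⟪v, ρ g⁻¹ w⟫_ℂ := by
  have hw : ρ g (ρ g⁻¹ w) = w := by
    change (ρ g * ρ g⁻¹) w = w
    rw [← map_mul, mul_inv_cancel, map_one]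
    rfl
  conv_lhs => rw [← hw]
  exact hρu g v (ρ g⁻¹ w)

end algebra

section projector

variable (μ : Measure G) (ρ : G →* (E →L[ℂ] E)) (χ : G →* ℂ)

omit [CompleteSpace E] in
/-- The integrand `g ↦ χ(g) • ρ(g)v` is integrable (continuous on a compact group, finite measure). -/
theorem integrable_smul_rep [CompactSpace G] [OpensMeasurableSpace G] [IsFiniteMeasureOnCompacts μ]
    (hχc : Continuous χ) (hρc : ∀ v : E, Continuous fun g : G => ρ g v) (v : E) :
    Integrable (fun g : G => χ g • ρ g v) μ :=
  (hχc.smul (hρc v)).integrable_of_hasCompactSupport (HasCompactSupport.of_compactSpace _)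

omit [CompleteSpace E] in
/-- The integrand of the local factor is integrable. -/
theorem integrable_localFactor [CompactSpace G] [OpensMeasurableSpace G]
    [IsFiniteMeasureOnCompacts μ] (hχc : Continuous χ)
    (hρc : ∀ v : E, Continuous fun g : G => ρ g v) (φ w : E) :
    Integrable (fun g : G => χ g * ⟪w, ρ g φ⟫_ℂ) μ :=
  (hχc.mul (continuous_const.inner (hρc φ))).integrable_of_hasCompactSupport
    (HasCompactSupport.of_compactSpace _)

variable {μ ρ χ}

/-- Equivariance: `ρ(h) P v = χ̄(h) P v` — `P` maps into the `χ̄`-isotypic subspace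
(left invariance of `μ`). -/
theorem isoProj_mem_isotypic [CompactSpace G] [OpensMeasurableSpace G]
    [IsFiniteMeasureOnCompacts μ] [IsTopologicalGroup G] [MeasurableMul G]
    [μ.IsMulLeftInvariant] (hχc : Continuous χ) (hχ1 : ∀ g, ‖χ g‖ = 1)
    (hρc : ∀ v : E, Continuous fun g : G => ρ g v) (v : E) :
    IsIsotypic ρ χ (isoProj μ ρ χ v) := by
  intro h
  rw [isoProj, ← ContinuousLinearMap.integral_comp_comm _ (integrable_smul_rep μ ρ χ hχc hρc v)]
  have hpt : ∀ g : G, ρ h (χ g • ρ g v) = conj (χ h) • (χ (h * g) • ρ (h * g) v) := by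
    intro g
    have hmul : ρ h (ρ g v) = ρ (h * g) v := by
      rw [map_mul]
      rfl
    rw [ContinuousLinearMap.map_smul, hmul, map_mul χ, smul_smul, ← mul_assoc,
      conj_char_mul hχ1 h, one_mul]
  simp_rw [hpt]
  rw [integral_smul, integral_mul_left_eq_self (fun g => χ g • ρ g v) h]

omit [TopologicalSpace G] in
/-- `P` fixes `χ̄`-isotypic vectors (probability normalisation of `μ`). -/
theorem isoProj_eq_self_of_mem [IsProbabilityMeasure μ] (hχ1 : ∀ g, ‖χ g‖ = 1) {v : E}
    (hv : IsIsotypic ρ χ v) : isoProj μ ρ χ v = v := by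
  rw [isoProj]
  have hpt : ∀ g : G, χ g • ρ g v = v := by
    intro g
    rw [hv g, smul_smul, char_mul_conj hχ1 g, one_smul]
  simp_rw [hpt]
  rw [integral_const, probReal_univ, one_smul]

/-- `P ∘ P = P`. -/
theorem isoProj_idem [CompactSpace G] [BorelSpace G] [IsProbabilityMeasure μ]
    [IsTopologicalGroup G] [μ.IsMulLeftInvariant] (hχc : Continuous χ) (hχ1 : ∀ g, ‖χ g‖ = 1)
    (hρc : ∀ v : E, Continuous fun g : G => ρ g v) (v : E) :
    isoProj μ ρ χ (isoProj μ ρ χ v) = isoProj μ ρ χ v :=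
  isoProj_eq_self_of_mem hχ1 (isoProj_mem_isotypic hχc hχ1 hρc v)

/-- `⟪w, P v⟫ = ∫ χ(g) ⟪w, ρ(g) v⟫`. -/
theorem inner_isoProj_right [CompactSpace G] [OpensMeasurableSpace G]
    [IsFiniteMeasureOnCompacts μ] (hχc : Continuous χ)
    (hρc : ∀ v : E, Continuous fun g : G => ρ g v) (w v : E) :
    ⟪w, isoProj μ ρ χ v⟫_ℂ = ∫ g, χ g * ⟪w, ρ g v⟫_ℂ ∂μ := by
  rw [isoProj, ← integral_inner (integrable_smul_rep μ ρ χ hχc hρc v)]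
  simp_rw [inner_smul_right]

/-- `P` is self-adjoint: `⟪P v, w⟫ = ⟪v, P w⟫` (unitarity of `ρ`, inversion invariance of `μ`). -/
theorem inner_isoProj_comm [CompactSpace G] [BorelSpace G] [IsFiniteMeasureOnCompacts μ]
    [IsTopologicalGroup G] [μ.IsInvInvariant] (hχc : Continuous χ) (hχ1 : ∀ g, ‖χ g‖ = 1)
    (hρu : ∀ g (v w : E), ⟪ρ g v, ρ g w⟫_ℂ = ⟪v, w⟫_ℂ)
    (hρc : ∀ v : E, Continuous fun g : G => ρ g v) (v w : E) :
    ⟪isoProj μ ρ χ v, w⟫_ℂ = ⟪v, isoProj μ ρ χ w⟫_ℂ := by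
  rw [← inner_conj_symm, inner_isoProj_right hχc hρc, inner_isoProj_right hχc hρc,
    ← integral_conj]
  have hpt : ∀ g : G, conj (χ g * ⟪w, ρ g v⟫_ℂ) = χ g⁻¹ * ⟪v, ρ g⁻¹ w⟫_ℂ := by
    intro g
    rw [map_mul, inner_conj_symm, inner_rep_left hρu, char_inv_eq_conj hχ1]
  simp_rw [hpt]
  exact integral_inv_eq_self (fun g => χ g * ⟪v, ρ g w⟫_ℂ) μ

/-- **tex l. 614: `I_v(φ_v) = vol · ‖φ_v[χ̄'_v]‖²`** (Haar probability measure, `vol = 1`):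
`∫ χ(g)⟪φ, ρ(g)φ⟫ dμ = ‖P φ‖²`. -/
theorem localFactor_eq_norm_sq [CompactSpace G] [BorelSpace G] [IsProbabilityMeasure μ]
    [IsTopologicalGroup G] [μ.IsMulLeftInvariant] [μ.IsInvInvariant] (hχc : Continuous χ)
    (hχ1 : ∀ g, ‖χ g‖ = 1) (hρu : ∀ g (v w : E), ⟪ρ g v, ρ g w⟫_ℂ = ⟪v, w⟫_ℂ)
    (hρc : ∀ v : E, Continuous fun g : G => ρ g v) (φ : E) :
    localFactor μ ρ χ φ = ((‖isoProj μ ρ χ φ‖ ^ 2 : ℝ) : ℂ) := by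
  rw [localFactor, ← inner_isoProj_right hχc hρc, ← isoProj_idem hχc hχ1 hρc φ,
    ← inner_isoProj_comm hχc hχ1 hρu hρc, isoProj_idem hχc hχ1 hρc φ, inner_self_eq_norm_sq_to_K]
  norm_cast

/-- tex l. 612: `I_v(φ_v) ≥ 0` (here a COROLLARY of the projection formula, no Bochner theorem). -/
theorem localFactor_re_nonneg [CompactSpace G] [BorelSpace G] [IsProbabilityMeasure μ]
    [IsTopologicalGroup G] [μ.IsMulLeftInvariant] [μ.IsInvInvariant] (hχc : Continuous χ)
    (hχ1 : ∀ g, ‖χ g‖ = 1) (hρu : ∀ g (v w : E), ⟪ρ g v, ρ g w⟫_ℂ = ⟪v, w⟫_ℂ)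
    (hρc : ∀ v : E, Continuous fun g : G => ρ g v) (φ : E) :
    0 ≤ (localFactor μ ρ χ φ).re ∧ (localFactor μ ρ χ φ).im = 0 := by
  rw [localFactor_eq_norm_sq hχc hχ1 hρu hρc φ, ofReal_re, ofReal_im]
  exact ⟨by positivity, rfl⟩

/-- `I_v(φ_v) ≠ 0` iff the `χ̄'_v`-isotypic component `φ_v[χ̄'_v]` is non-zero (tex l. 614–615). -/
theorem localFactor_ne_zero_iff [CompactSpace G] [BorelSpace G] [IsProbabilityMeasure μ]
    [IsTopologicalGroup G] [μ.IsMulLeftInvariant] [μ.IsInvInvariant] (hχc : Continuous χ)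
    (hχ1 : ∀ g, ‖χ g‖ = 1) (hρu : ∀ g (v w : E), ⟪ρ g v, ρ g w⟫_ℂ = ⟪v, w⟫_ℂ)
    (hρc : ∀ v : E, Continuous fun g : G => ρ g v) (φ : E) :
    localFactor μ ρ χ φ ≠ 0 ↔ isoProj μ ρ χ φ ≠ 0 := by
  rw [localFactor_eq_norm_sq hχc hχ1 hρu hρc φ, ne_eq, ofReal_eq_zero, pow_eq_zero_iff two_ne_zero,
    norm_eq_zero]

omit [TopologicalSpace G] [CompleteSpace E] in
/-- "non-zero for suitable `φ_v`" (tex l. 615–617): a nonzero `χ̄'_v`-isotypic vector `v` (supplied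
at real places by Lemma 4.1(a), node N27, and at non-split finite places by local occurrence,
node N31a) has `I_v(v) = ‖v‖² > 0`. -/
theorem localFactor_eq_of_isotypic [IsProbabilityMeasure μ] (hχ1 : ∀ g, ‖χ g‖ = 1) {v : E}
    (hv : IsIsotypic ρ χ v) :
    localFactor μ ρ χ v = ((‖v‖ ^ 2 : ℝ) : ℂ) := by
  rw [localFactor]
  have hpt : ∀ g : G, χ g * ⟪v, ρ g v⟫_ℂ = ((‖v‖ ^ 2 : ℝ) : ℂ) := by
    intro g
    rw [hv g, inner_smul_right, ← mul_assoc, char_mul_conj hχ1 g, one_mul,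
      inner_self_eq_norm_sq_to_K]
    norm_cast
  simp_rw [hpt]
  rw [integral_const, probReal_univ, one_smul]

omit [TopologicalSpace G] [CompleteSpace E] in
/-- (Ported verbatim from the HodgeCMPerL package; no docstring in the source.) -/
theorem localFactor_pos_of_isotypic [IsProbabilityMeasure μ] (hχ1 : ∀ g, ‖χ g‖ = 1) {v : E}
    (hv : IsIsotypic ρ χ v) (hv0 : v ≠ 0) :
    0 < (localFactor μ ρ χ v).re := by
  rw [localFactor_eq_of_isotypic hχ1 hv, ofReal_re]
  exact pow_pos (norm_pos_iff.mpr hv0) 2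

end projector

/-! ### The compact abelian case of PerL (all invariances inferred by Mathlib) -/

/-- For a compact ABELIAN group (PerL l. 613: "the abelian group `U(W_i)(L_{0,v})`") with its Haar
probability measure every hypothesis on `μ` above is automatic. -/
theorem localFactor_eq_norm_sq_haar {A : Type*} [CommGroup A] [TopologicalSpace A]
    [IsTopologicalGroup A] [CompactSpace A] [MeasurableSpace A] [BorelSpace A]
    (μ : Measure A) [μ.IsHaarMeasure] [IsProbabilityMeasure μ]
    (ρ : A →* (E →L[ℂ] E)) (χ : A →* ℂ) (hχc : Continuous χ) (hχ1 : ∀ g, ‖χ g‖ = 1)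
    (hρu : ∀ g (v w : E), ⟪ρ g v, ρ g w⟫_ℂ = ⟪v, w⟫_ℂ)
    (hρc : ∀ v : E, Continuous fun g : A => ρ g v) (φ : E) :
    localFactor μ ρ χ φ = ((‖isoProj μ ρ χ φ‖ ^ 2 : ℝ) : ℂ) :=
  localFactor_eq_norm_sq hχc hχ1 hρu hρc φ

end LocalFactors
end PerL34
end HodgeCM
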